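import Summits.HodgeConjecture.CorCM.Census.QuarticInversionStabiliser
import Summits.HodgeConjecture.CorCM.Census.BlockParityBurnside

/-!
# The quartic inversion twists: the number of blocks in closed form (`B` without elements of order `4`)

COR-CM (cell `pub-hodgecm2`, stage 2 of the Hodge ladder), count-neutral KERNEL COMBINATORICS by the binder seat b23 (gen 44; claim
QUARTIC-INVERSION, HOME/INBOX.md l.12829).  Theorems only, on top of `Census/QuarticInversion{Dictionary,Cosets,Stabiliser}.lean` and seat b09's
Burnside count `Census/BlockParityBurnside.lean` (`card_block_mul_card`: `β · |G| = Σ_g [c ∉ ⟨g⟩] 2^{|G|/ord g/2}`) used BY NAME; no `decide` beyond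
closed identities in `ZMod 2`/small numerals, no certificate, no named fact, no `sorry`.  `Interfaces.lean` (C1), every E term, B01, `Transposition/*`,
`PortJoin/*` untouched.  HONEST FRAMING: `HC_CM` is NOT proved, here or anywhere in the tree; nothing here is a period, a count of record or a headline.

THE COUNT.  Along a quartic inversion datum `D : Datum G c B ζ` over a finite abelian `B` WITHOUT elements of order `4`, the four cosets contribute
to b09's Burnside sum as follows: `ι(e, s)` contributes unless `e = 1` and `ord s` is odd (`c ∈ ⟨ι(e,s)⟩ ↔ e = 1 ∧ ord s odd`), with
`ord ι(0,s) = ord s = ord ι(1,s)` (the latter for `ord s` even), i.e. `(1 + [ord s even]) · 16^{|B|/ord s}` per `s`; `t ι a` contributes nothing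
(`c ∈ ⟨t ι a⟩`, here `4 ∤ ord s` is used); `y ι a` and `t y ι a` square to `ι(ζ, 0)`: nothing for `ζ = 1`, and `4^{|B|}` each (involutions) for
`ζ = 0`.  Hence
* **ζ = 1 (`Dic(ℤ/4 × B)`): `β · 8|B| = Σ_{s ∈ B} (1 + [ord s even]) · 16^{|B| / ord s}`** (`card_block_mul_of_one`);
* **ζ = 0 (`D(ℤ/4 × B)`): `β · 8|B| = Σ_{s ∈ B} (1 + [ord s even]) · 16^{|B| / ord s} + 4|B| · 4^{|B|}`** (`card_block_mul_of_zero`);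
and the rows `β(Q₈) = 2`, `β(D₄, r²) = 4` (`|B| = 1`), `β(Dic₆) = 172`, `β(D₁₂, r⁶) = 204` (`|B| = 3`, prime), `β(Q₈ × ℤ/2) = 18`, `β(D₄ × ℤ/2, r²) = 26`
(`B` of exponent two with `|B| = 2`).  With the floors of `…Stabiliser` (`μ ≥ β` resp. `μ ≥ β − 2`) these are the lower halves of the two laws in
closed form (lit-andre-3's `Dic₆` floor `172`, b30's octic rows `Q₈: 2`, `D₄: 2 = 4 − 2`).  All [folklore].

## References
* [Milne1999] J. S. Milne, Lefschetz motives and the Tate conjecture, Compositio Math. 117 (1999), Prop. 2.1, p. 54.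
-/

namespace Summit.HodgeConjecture.CorCM.Census.QuarticInversion

open Finset
open Summit.HodgeConjecture.CorCM.Prior.AllgGroup.RfwfAllgGroup
open Summit.HodgeConjecture.CorCM.Census.BlockParity
open Summit.HodgeConjecture.CorCM.Census.TypeStabiliser

noncomputable section

section Generic

variable {G : Type*} [Group G] {c : G} {A : Type} [AddCommGroup A] {ζ : ZMod 2} (D : Datum G c A ζ)

/-! ## §1 Orders and `c`-membership in the coset `ι(ℤ/2 × B)` -/

/-- `ιHom` is injective. [folklore] -/
theorem ιHom_injective : Function.Injective (ιHom D) := fun _ _ h => Multiplicative.toAdd.injective (D.inj h)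

/-- **`ι` preserves orders**: `ord ι(e, s) = ord (e, s)`. [folklore] -/
theorem orderOf_ι_mk (e : ZMod 2) (s : A) : orderOf (D.ι (e, s)) = addOrderOf ((e, s) : ZMod 2 × A) := by
  rw [← ιHom_apply, orderOf_injective (ιHom D) (ιHom_injective D), orderOf_ofAdd_eq_addOrderOf]

omit [AddCommGroup A] in
/-- `ord (0, s) = ord s`. [folklore] -/
theorem addOrderOf_zero_mk [AddCommGroup A] (s : A) : addOrderOf (((0 : ZMod 2), s) : ZMod 2 × A) = addOrderOf s := by
  rw [Prod.addOrderOf_mk, addOrderOf_zero, Nat.lcm_one_left]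

omit [AddCommGroup A] in
/-- For `ord s` even, `ord (1, s) = ord s`. [folklore] -/
theorem addOrderOf_one_mk_of_even [AddCommGroup A] {s : A} (hs : Even (addOrderOf s)) :
    addOrderOf (((1 : ZMod 2), s) : ZMod 2 × A) = addOrderOf s := by
  rw [Prod.addOrderOf_mk, ZMod.addOrderOf_one]
  exact Nat.lcm_eq_right (even_iff_two_dvd.mp hs)

/-- **`c ∈ ⟨ι a⟩ ↔ a.1 = 1 ∧ ord a.2` odd.** [folklore] -/
theorem c_mem_zpowers_ι_iff_odd' (a : ZMod 2 × A) : c ∈ Subgroup.zpowers (D.ι a) ↔ a.1 = 1 ∧ Odd (addOrderOf a.2) := by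
  obtain ⟨e, s⟩ := a
  show c ∈ Subgroup.zpowers (D.ι (e, s)) ↔ e = 1 ∧ Odd (addOrderOf s)
  constructor
  · intro h
    obtain ⟨k, hk⟩ := Subgroup.mem_zpowers_iff.mp h
    rw [ι_zpow] at hk
    have hks : k • ((e, s) : ZMod 2 × A) = ((1 : ZMod 2), (0 : A)) := D.inj (hk.trans D.map_c.symm)
    have h1 : k • e = 1 := by simpa using congrArg Prod.fst hks
    have h2 : k • s = 0 := by simpa using congrArg Prod.snd hks
    have hkodd : Odd k := by
      rcases Int.even_or_odd k with ⟨j, rfl⟩ | hodd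
      · exfalso
        have key2 : ∀ u : ZMod 2, u + u = 0 := by decide
        rw [add_zsmul, key2] at h1
        exact zero_ne_one h1
      · exact hodd
    have key : ∀ u : ZMod 2, u ≠ 0 → u = 1 := by decide
    refine ⟨key e fun he => ?_, ?_⟩
    · rw [he, smul_zero] at h1
      exact zero_ne_one h1
    · have hdvd : (addOrderOf s : ℤ) ∣ k := addOrderOf_dvd_iff_zsmul_eq_zero.mpr h2
      obtain ⟨j, hj⟩ := hkodd
      rw [Int.natCast_dvd] at hdvd
      have hodd' : Odd k.natAbs := by
        rw [Int.natAbs_odd]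
        exact ⟨j, hj⟩
      exact hodd'.of_dvd_nat hdvd
  · rintro ⟨rfl, hodd⟩
    refine Subgroup.mem_zpowers_iff.mpr ⟨(addOrderOf s : ℤ), ?_⟩
    have hn : addOrderOf s • ((1 : ZMod 2), s) = (1, 0) := by
      rw [Prod.smul_mk, addOrderOf_nsmul_eq_zero, nsmul_eq_mul, mul_one, ← ZMod.natCast_mod, Nat.odd_iff.mp hodd, Nat.cast_one]
    rw [zpow_natCast, ι_pow, hn]
    exact D.map_c

end Generic

/-! ## §2 The Burnside sum along the four cosets -/

section Count

variable {G : Type*} [Group G] [Fintype G] [DecidableEq G] {c : G}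
variable {A : Type} [AddCommGroup A] [Fintype A] [DecidableEq A] {ζ : ZMod 2} (D : Datum G c A ζ)

omit [DecidableEq G] [DecidableEq A] in
include D in
/-- The contribution of the coset `ι(ℤ/2 × B)` to the Burnside sum: `Σ_{s} (1 + [ord s even]) · 16^{|B|/ord s}`. [folklore] -/
theorem sum_ι_coset :
    ∑ a : ZMod 2 × A, (if c ∈ Subgroup.zpowers (D.ι a) then 0 else 2 ^ (Fintype.card G / orderOf (D.ι a) / 2)) =
      ∑ s : A, (if Even (addOrderOf s) then 2 else 1) * 16 ^ (Fintype.card A / addOrderOf s) := by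
  classical
  rw [Fintype.sum_prod_type_right]
  refine Finset.sum_congr rfl fun s _ => ?_
  have huniv : (Finset.univ : Finset (ZMod 2)) = {0, 1} := by decide
  have h0 : ¬ (c ∈ Subgroup.zpowers (D.ι (0, s))) := fun h => zero_ne_one ((c_mem_zpowers_ι_iff_odd' D (0, s)).mp h).1
  rw [huniv, Finset.sum_pair (show (0 : ZMod 2) ≠ 1 by decide), if_neg h0, orderOf_ι_mk, addOrderOf_zero_mk, card_eq_eight_mul D]
  obtain ⟨d, hd⟩ := addOrderOf_dvd_card (x := s)
  have hpos : 0 < addOrderOf s := addOrderOf_pos s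
  have hdiv : Fintype.card A / addOrderOf s = d := by rw [hd, Nat.mul_div_cancel_left d hpos]
  have hdiv' : 8 * Fintype.card A / addOrderOf s / 2 = 4 * d := by
    rw [hd, show 8 * (addOrderOf s * d) = addOrderOf s * (8 * d) by ring, Nat.mul_div_cancel_left _ hpos]
    omega
  rw [hdiv, hdiv', pow_mul, show (2 : ℕ) ^ 4 = 16 by norm_num]
  by_cases hev : Even (addOrderOf s)
  · have h1 : ¬ (c ∈ Subgroup.zpowers (D.ι (1, s))) := fun h =>
      (Nat.not_odd_iff_even.mpr hev) ((c_mem_zpowers_ι_iff_odd' D (1, s)).mp h).2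
    rw [if_neg h1, if_pos hev, orderOf_ι_mk, addOrderOf_one_mk_of_even hev, hdiv', pow_mul, show (2 : ℕ) ^ 4 = 16 by norm_num]
    ring
  · have h1 : c ∈ Subgroup.zpowers (D.ι (1, s)) := (c_mem_zpowers_ι_iff_odd' D (1, s)).mpr ⟨rfl, Nat.not_even_iff_odd.mp hev⟩
    rw [if_pos h1, if_neg hev]
    ring

omit [Fintype G] [DecidableEq G] [Fintype A] [DecidableEq A] in
/-- The coset `t ι(ℤ/2 × B)` contributes nothing when `B` has no element of order `4`. [folklore] -/
theorem sum_tι_coset_eq_zero (hB : ∀ s : A, ¬ 4 ∣ addOrderOf s) (f : G → ℕ) :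
    (fun a : ZMod 2 × A => if c ∈ Subgroup.zpowers (D.t * D.ι a) then 0 else f (D.t * D.ι a)) = fun _ => 0 := by
  funext a
  rw [if_pos (c_mem_zpowers_tι D a (hB a.2))]

omit [DecidableEq A] in
include D in
/-- **b09's Burnside sum reindexed along the four cosets.** [folklore] -/
theorem card_block_mul_card_eq_sum_cosets (hc2 : c * c = 1) :
    Fintype.card (BlockParity.Block c) * Fintype.card G =
      ∑ p : Fin 4 × (ZMod 2 × A), (if c ∈ Subgroup.zpowers (cosetElt D p.1 p.2) then 0 else
        2 ^ (Fintype.card G / orderOf (cosetElt D p.1 p.2) / 2)) := by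
  classical
  rw [card_block_mul_card c hc2 (mul_c_comm D), ← Equiv.sum_comp (cosetEquiv D)]
  rfl

end Count

/-! ## §3 The two closed forms -/

section One

variable {G : Type*} [Group G] [Fintype G] [DecidableEq G] {c : G}
variable {A : Type} [AddCommGroup A] [Fintype A] [DecidableEq A] (D : Datum G c A 1)

omit [DecidableEq A] in
include D in
/-- **ζ = 1, `B` without elements of order `4`: `β(G, c) · 8|B| = Σ_{s ∈ B} (1 + [ord s even]) · 16^{|B| / ord s}`.** [folklore] -/
theorem card_block_mul_of_one (hc2 : c * c = 1) (hB : ∀ s : A, ¬ 4 ∣ addOrderOf s) :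
    Fintype.card (BlockParity.Block c) * (8 * Fintype.card A) =
      ∑ s : A, (if Even (addOrderOf s) then 2 else 1) * 16 ^ (Fintype.card A / addOrderOf s) := by
  classical
  rw [← card_eq_eight_mul D, card_block_mul_card_eq_sum_cosets D hc2, Fintype.sum_prod_type, Fin.sum_univ_four]
  simp only [cosetElt, Matrix.cons_val_zero, Matrix.cons_val_one, Matrix.cons_val]
  rw [sum_ι_coset D]
  have hy : ∀ a : ZMod 2 × A, c ∈ Subgroup.zpowers (D.y * D.ι a) := c_mem_zpowers_yι_of_one D
  have hty : ∀ a : ZMod 2 × A, c ∈ Subgroup.zpowers (D.t * (D.y * D.ι a)) := c_mem_zpowers_tyι_of_one D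
  have ht : ∀ a : ZMod 2 × A, c ∈ Subgroup.zpowers (D.t * D.ι a) := fun a => c_mem_zpowers_tι D a (hB a.2)
  simp only [hy, hty, ht, if_true, Finset.sum_const_zero, add_zero]

omit [DecidableEq A] in
include D in
/-- **`β(Q₈) = 2`**, and more generally `β = 2` for `|B| = 1` and `ζ = 1`. [folklore] -/
theorem card_block_eq_two (hc2 : c * c = 1) (h1 : Fintype.card A = 1) : Fintype.card (BlockParity.Block c) = 2 := by
  have hB : ∀ s : A, ¬ 4 ∣ addOrderOf s := fun s h => by
    have := addOrderOf_dvd_card (x := s); rw [h1] at this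
    have h1' : addOrderOf s = 1 := Nat.dvd_one.mp this
    omega
  have h := card_block_mul_of_one D hc2 hB
  have hterm : ∀ s : A, (if Even (addOrderOf s) then 2 else 1) * 16 ^ (Fintype.card A / addOrderOf s) = 16 := fun s => by
    have h1' : addOrderOf s = 1 := Nat.dvd_one.mp (by have := addOrderOf_dvd_card (x := s); rwa [h1] at this)
    rw [h1', h1]; norm_num
  rw [Finset.sum_congr rfl fun s _ => hterm s, Finset.sum_const, Finset.card_univ, h1] at h
  norm_num at h
  omega

include D in
/-- **`β = 172` for `|B| = 3`, `ζ = 1`** (`G = Dic₆`, lit-andre-3's `Census/TwentyFourDicyclic*` row): `β · 24 = 16³ + 2 · 16`. [folklore] -/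
theorem card_block_eq_oneHundredSeventyTwo (hc2 : c * c = 1) (h3 : Fintype.card A = 3) : Fintype.card (BlockParity.Block c) = 172 := by
  classical
  have hord : ∀ s : A, s ≠ 0 → addOrderOf s = 3 := fun s hs => by
    have hd := addOrderOf_dvd_card (x := s); rw [h3] at hd
    rcases (Nat.dvd_prime Nat.prime_three).mp hd with h | h
    · exact absurd (AddMonoid.addOrderOf_eq_one_iff.mp h) hs
    · exact h
  have hB : ∀ s : A, ¬ 4 ∣ addOrderOf s := fun s h => by
    by_cases hs : s = 0
    · rw [hs, addOrderOf_zero] at h; omega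
    · rw [hord s hs] at h; omega
  have h := card_block_mul_of_one D hc2 hB
  rw [← Finset.add_sum_erase _ _ (Finset.mem_univ (0 : A)), addOrderOf_zero, Nat.div_one, if_neg (by decide), one_mul, h3] at h
  have hterm : ∀ s ∈ (Finset.univ : Finset A).erase 0, (if Even (addOrderOf s) then 2 else 1) * 16 ^ (3 / addOrderOf s) = 16 := by
    intro s hs
    rw [hord s (Finset.ne_of_mem_erase hs)]; norm_num
  rw [Finset.sum_congr rfl hterm, Finset.sum_const, Finset.card_erase_of_mem (Finset.mem_univ _), Finset.card_univ, h3] at h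
  norm_num at h
  omega

include D in
/-- **`β = 18` for `B` of exponent two with `|B| = 2`, `ζ = 1`** (`G = Q₈ × ℤ/2`): `β · 16 = 16² + 2 · 16`. [folklore] -/
theorem card_block_eq_eighteen (hc2 : c * c = 1) (h2 : Fintype.card A = 2) : Fintype.card (BlockParity.Block c) = 18 := by
  classical
  have hord : ∀ s : A, s ≠ 0 → addOrderOf s = 2 := fun s hs => by
    have hd := addOrderOf_dvd_card (x := s); rw [h2] at hd
    rcases (Nat.dvd_prime Nat.prime_two).mp hd with h | h
    · exact absurd (AddMonoid.addOrderOf_eq_one_iff.mp h) hs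
    · exact h
  have hB : ∀ s : A, ¬ 4 ∣ addOrderOf s := fun s h => by
    by_cases hs : s = 0
    · rw [hs, addOrderOf_zero] at h; omega
    · rw [hord s hs] at h; omega
  have h := card_block_mul_of_one D hc2 hB
  rw [← Finset.add_sum_erase _ _ (Finset.mem_univ (0 : A)), addOrderOf_zero, Nat.div_one, if_neg (by decide), one_mul, h2] at h
  have hterm : ∀ s ∈ (Finset.univ : Finset A).erase 0, (if Even (addOrderOf s) then 2 else 1) * 16 ^ (2 / addOrderOf s) = 32 := by
    intro s hs
    rw [hord s (Finset.ne_of_mem_erase hs)]; norm_num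
  rw [Finset.sum_congr rfl hterm, Finset.sum_const, Finset.card_erase_of_mem (Finset.mem_univ _), Finset.card_univ, h2] at h
  norm_num at h
  omega

end One

section Zero

variable {G : Type*} [Group G] [Fintype G] [DecidableEq G] {c : G}
variable {A : Type} [AddCommGroup A] [Fintype A] [DecidableEq A] (D : Datum G c A 0)

omit [Fintype G] [DecidableEq G] [Fintype A] [DecidableEq A] in
include D in
/-- For `ζ = 0`, the elements `y ι a`, `t y ι a` are involutions, have order two and miss `c`. [folklore] -/
theorem involution_facts {g : G} (hg : g * g = 1) (hg1 : g ≠ 1) (hgc : g ≠ c) :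
    orderOf g = 2 ∧ c ∉ Subgroup.zpowers g :=
  ⟨orderOf_eq_prime (by rw [pow_two]; exact hg) hg1, notMem_zpowers_of_mul_self_eq_one c hg (c_ne_one D) hgc⟩

omit [DecidableEq A] in
include D in
/-- **ζ = 0, `B` without elements of order `4`: `β(G, c) · 8|B| = Σ_{s ∈ B} (1 + [ord s even]) · 16^{|B| / ord s} + 4|B| · 4^{|B|}`.** [folklore] -/
theorem card_block_mul_of_zero (hc2 : c * c = 1) (hB : ∀ s : A, ¬ 4 ∣ addOrderOf s) :
    Fintype.card (BlockParity.Block c) * (8 * Fintype.card A) =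
      ∑ s : A, (if Even (addOrderOf s) then 2 else 1) * 16 ^ (Fintype.card A / addOrderOf s) + 4 * Fintype.card A * 4 ^ Fintype.card A := by
  classical
  rw [← card_eq_eight_mul D, card_block_mul_card_eq_sum_cosets D hc2, Fintype.sum_prod_type, Fin.sum_univ_four]
  simp only [cosetElt, Matrix.cons_val_zero, Matrix.cons_val_one, Matrix.cons_val]
  rw [sum_ι_coset D]
  have ht : ∀ a : ZMod 2 × A, c ∈ Subgroup.zpowers (D.t * D.ι a) := fun a => c_mem_zpowers_tι D a (hB a.2)
  have hy : ∀ a : ZMod 2 × A, orderOf (D.y * D.ι a) = 2 ∧ c ∉ Subgroup.zpowers (D.y * D.ι a) := fun a =>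
    involution_facts D (by rw [yι_sq]; exact ι_zero D) (fun h => ι_ne_yι D 0 a (by rw [ι_zero]; exact h.symm))
      (fun h => ι_ne_yι D (1, 0) a (by rw [D.map_c]; exact h.symm))
  have hty : ∀ a : ZMod 2 × A, orderOf (D.t * (D.y * D.ι a)) = 2 ∧ c ∉ Subgroup.zpowers (D.t * (D.y * D.ι a)) := fun a =>
    involution_facts D (by rw [tyι_sq]; exact ι_zero D) (fun h => ι_ne_tyι D 0 a (by rw [ι_zero]; exact h.symm))
      (fun h => ι_ne_tyι D (1, 0) a (by rw [D.map_c]; exact h.symm))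
  have hdiv : 8 * Fintype.card A / 2 / 2 = 2 * Fintype.card A := by omega
  simp only [ht, if_true, Finset.sum_const_zero, add_zero, (hy _).1, (hy _).2, (hty _).1, (hty _).2, if_false, card_eq_eight_mul D, hdiv,
    Finset.sum_const, Finset.card_univ, smul_eq_mul, Fintype.card_prod, ZMod.card]
  rw [pow_mul, show (2 : ℕ) ^ 2 = 4 by norm_num]
  ring

omit [DecidableEq A] in
include D in
/-- **`β(D₄, r²) = 4`**, and more generally `β = 4` for `|B| = 1` and `ζ = 0`: `β · 8 = 16 + 4 · 4`. [folklore] -/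
theorem card_block_eq_four (hc2 : c * c = 1) (h1 : Fintype.card A = 1) : Fintype.card (BlockParity.Block c) = 4 := by
  have h1' : ∀ s : A, addOrderOf s = 1 := fun s => Nat.dvd_one.mp (by have := addOrderOf_dvd_card (x := s); rwa [h1] at this)
  have hB : ∀ s : A, ¬ 4 ∣ addOrderOf s := fun s h => by rw [h1' s] at h; omega
  have h := card_block_mul_of_zero D hc2 hB
  have hterm : ∀ s : A, (if Even (addOrderOf s) then 2 else 1) * 16 ^ (Fintype.card A / addOrderOf s) = 16 := fun s => by
    rw [h1' s, h1]; norm_num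
  rw [Finset.sum_congr rfl fun s _ => hterm s, Finset.sum_const, Finset.card_univ, h1] at h
  norm_num at h
  omega

include D in
/-- **`β = 204` for `|B| = 3`, `ζ = 0`** (`G = D₁₂` with `c = r⁶`): `β · 24 = 16³ + 2·16 + 12·64`. [folklore] -/
theorem card_block_eq_twoHundredFour (hc2 : c * c = 1) (h3 : Fintype.card A = 3) : Fintype.card (BlockParity.Block c) = 204 := by
  classical
  have hord : ∀ s : A, s ≠ 0 → addOrderOf s = 3 := fun s hs => by
    have hd := addOrderOf_dvd_card (x := s); rw [h3] at hd
    rcases (Nat.dvd_prime Nat.prime_three).mp hd with h | h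
    · exact absurd (AddMonoid.addOrderOf_eq_one_iff.mp h) hs
    · exact h
  have hB : ∀ s : A, ¬ 4 ∣ addOrderOf s := fun s h => by
    by_cases hs : s = 0
    · rw [hs, addOrderOf_zero] at h; omega
    · rw [hord s hs] at h; omega
  have h := card_block_mul_of_zero D hc2 hB
  rw [← Finset.add_sum_erase _ _ (Finset.mem_univ (0 : A)), addOrderOf_zero, Nat.div_one, if_neg (by decide), one_mul, h3] at h
  have hterm : ∀ s ∈ (Finset.univ : Finset A).erase 0, (if Even (addOrderOf s) then 2 else 1) * 16 ^ (3 / addOrderOf s) = 16 := by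
    intro s hs
    rw [hord s (Finset.ne_of_mem_erase hs)]; norm_num
  rw [Finset.sum_congr rfl hterm, Finset.sum_const, Finset.card_erase_of_mem (Finset.mem_univ _), Finset.card_univ, h3] at h
  norm_num at h
  omega

include D in
/-- **`β = 26` for `B` of exponent two with `|B| = 2`, `ζ = 0`** (`G = D₄ × ℤ/2` with `c = r²`): `β · 16 = 16² + 2·16 + 8·16`. [folklore] -/
theorem card_block_eq_twentySix (hc2 : c * c = 1) (h2 : Fintype.card A = 2) : Fintype.card (BlockParity.Block c) = 26 := by
  classical
  have hord : ∀ s : A, s ≠ 0 → addOrderOf s = 2 := fun s hs => by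
    have hd := addOrderOf_dvd_card (x := s); rw [h2] at hd
    rcases (Nat.dvd_prime Nat.prime_two).mp hd with h | h
    · exact absurd (AddMonoid.addOrderOf_eq_one_iff.mp h) hs
    · exact h
  have hB : ∀ s : A, ¬ 4 ∣ addOrderOf s := fun s h => by
    by_cases hs : s = 0
    · rw [hs, addOrderOf_zero] at h; omega
    · rw [hord s hs] at h; omega
  have h := card_block_mul_of_zero D hc2 hB
  rw [← Finset.add_sum_erase _ _ (Finset.mem_univ (0 : A)), addOrderOf_zero, Nat.div_one, if_neg (by decide), one_mul, h2] at h
  have hterm : ∀ s ∈ (Finset.univ : Finset A).erase 0, (if Even (addOrderOf s) then 2 else 1) * 16 ^ (2 / addOrderOf s) = 32 := by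
    intro s hs
    rw [hord s (Finset.ne_of_mem_erase hs)]; norm_num
  rw [Finset.sum_congr rfl hterm, Finset.sum_const, Finset.card_erase_of_mem (Finset.mem_univ _), Finset.card_univ, h2] at h
  norm_num at h
  omega

end Zero

end

end Summit.HodgeConjecture.CorCM.Census.QuarticInversion
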